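import Literature.MathematicalPhysics.QuantumFieldTheory.Balaban1983to89.B16Sect1Wilson
import Literature.MathematicalPhysics.QuantumFieldTheory.Balaban1983to89.B16Sect1Kernels
import Literature.MathematicalPhysics.QuantumFieldTheory.Balaban1983to89.B15

/-!
# `Balaban1983to89.B16Ineq131Assembly` — T. Bałaban, *Large field renormalization. II. Localization, exponentiation, and
bounds for the 𝐑 operation*, Commun. Math. Phys. **122** (1989) 355–392 [Balaban1989LargeFieldII], Sect. 1 p. 364
display **(1.31)** (SKELETON row B16.Eq1.31) — `0 ≦ A(ζ₁, U₀) < g_k²L^{−4N}N^{4β₀}O(1)A₀²B₃²B₅²M^{14}R_k⁴p₀²(g_k)` — ASSEMBLED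
at the object level of the localized Wilson action `A(ζ, U)` (`…B16Sect1Wilson.wilsonLoc`) from the inputs the cell
transcript ([CERT arithmetic] at (1.31)) identifies behind the one printed sentence: the support count of `ζ₁`, the
per-plaquette deviation of `U₀` from (1.80) [IV] (`…B15.Ineq180`, BY NAME), a trace inequality `1 − Re tr g ≦ κ|g − 1|²`,
and the two dictionary relations `ε_k = g_kA₀p₀(g_k)`, `R_{h+1} ≦ O(1)N^{β₀}R_k` — knitting the two pieces already PROVED in
the tree (`wilsonLoc_le_card_mul`, `B16Sect1Kernels.ineq131_arith`) into ONE implication ending in the typed row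
`B16Sect1Wilson.Ineq131`

statement-level skeleton of published theorems with citation tags; proofs where landed; nothing here is a claim about
the Yang–Mills mass gap

PDF held: `paper:balaban1989-cmp122-large-field-ii` (journal page = PDF page + 354); [IV] = [Balaban1989LargeFieldI]
(held `paper:balaban1989-cmp122-large-field-i`).  (1.31) was READ AS AN IMAGE by this seat on the x2 render
`run/shared/lean/pub/pub-balaban/b2b-balaban-ref1/pages/1989-cmp122-large-field-II/…-p010-x2.png` (p. 364).

CITATION HEADER / WHAT IS REPRODUCED (mega-formalization `lit-balaban`, reader/typer r13 gen 7; HOME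
`run/shared/lean/pub/lit-balaban/`, rows `lit-balaban-r13/ROWS-B16.md` v2.24): SKELETON row **B16.Eq1.31** (cell «typed
p238829 (leaf) · sign/counting proved p238829 · RHS arithmetic proved p239606»).

WHAT IS PRINTED (p. 364 [PDF 10], verbatim).  *"The second term on the right-hand side can be estimated as follows:
0 ≦ A(ζ₁, U₀) < g_k²L^{−4N}N^{4β₀}O(1)A₀²B₃²B₅²M^{14}R_k⁴p₀²(g_k). (1.31) For N satisfying the conditions discussed above the
bound on the right-hand side above is small, after dividing by g_k²."* — no derivation is printed; the cell transcript
reconstructs it as (number of η-plaquettes in `supp ζ₁ ⊂ Z″_{h+1}`, `≦ O(1)M⁴R_{h+1}⁴L^{−4N}η⁻⁴`) × (per-plaquette term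
`≦ (O(1)B₃B₅M⁵ε_kη²)²` from (1.80) [IV]) with `ε_k = g_kA₀p₀(g_k)` ([III] (2.2)) and `R_{h+1} ≦ O(1)N^{β₀}R_k`.

WHAT IS HERE (every `theorem` PROVED; all inputs explicit hypotheses, ref-1 F6).
* `dev_sq_le_of_ineq180` — (1.80) [IV] in its typed form `B15.Ineq180 dev ε_k η B₃ B₅ M δ dist C` with `e^{−δ dist} ≦ 1`
  and `2 ≦ C′B₃B₅M⁵ − CB₃B₅M⁵` absorbed: `dev ≦ C′B₃B₅M⁵ε_kη²` hence `κ·dev² ≦ (C′B₃B₅M⁵ε_kη²)²` for `κ ≦ 1`.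
* **`wilsonLoc_le_rhs131`** — for a weight `0 ≦ ζ₁ ≦ 1` supported in a finite plaquette set `S`, a configuration `U₀` whose
  plaquette variables on `S` obey the (1.80)-shape deviation bound `|U₀(∂p) − 1| ≦ C₂B₃B₅M⁵ε_kη²` (`hdev`), a trace
  inequality `1 − Re tr g ≦ κ|g − 1|²` with `κ ≦ 1` (`hquad`; `κ = ½` for `G ⊂ U(N)` in the operator norm — the abstract
  `Setup.GaugeGroup` does not fix the matrix model, DIVERGENCE F4), the count `#S ≦ C₁M⁴R_{h+1}⁴L^{−4N}η⁻⁴` (`hS`), `ε_k =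
  g_kA₀p₀(g_k)` (`hε`) and `R_{h+1} ≦ C₃N^{β₀}R_k` (`hR`): `A(ζ₁, U₀) ≦ g_k²L^{−4N}(N^{β₀})⁴(C₁C₂²C₃⁴)A₀²B₃²B₅²M^{14}R_k⁴p₀²(g_k)`
  — `wilsonLoc_le_card_mul` then `ineq131_arith`.
* **`ineq131_of_inputs`** — the row AS TYPED, `B16Sect1Wilson.Ineq131 (A(ζ₁,U₀)) g_k L⁻¹ N β₀ (C₁C₂²C₃⁴ + 1) A₀ B₃ B₅ M R_k
  p₀(g_k)`, from the same inputs (`L^{−4N} = (L⁻¹)^{4N}`, `(N^{β₀})⁴ = N^{4β₀}`; the printed STRICT `<` with the `O(1)`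
  explicit as `C₁C₂²C₃⁴ + 1`, the other factors positive).
NOT HERE: the count of `supp ζ₁` from the geometry of `∂Z″_{h+1}` and condition (i), the bound (1.80) [IV] itself, the
N-window (rows B16.Lem@363 / B16.Txt@361).  No `sorry`, no axiom; nothing printed is asserted as a fact.
-/

namespace Literature.MathematicalPhysics.QuantumFieldTheory.Balaban1983to89.B16Ineq131Assembly

open B16Sect1Wilson GaugeField Finset

variable {P : Params} {j : ℕ} {G : Type*} [GaugeGroup G]

/-- (1.80) [IV] in its typed form (`B15.Ineq180`: `dev < 2ε_kη² + CB₃B₅M⁵e^{−δ dist}ε_kη²`) gives the (1.80)-SHAPE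
deviation bound used at (1.31): with `0 ≦ δ·dist` (so `e^{−δ dist} ≦ 1`), `0 ≦ ε_k`, and a constant `C₂` with
`2 + CB₃B₅M⁵ ≦ C₂B₃B₅M⁵`, `dev ≦ C₂B₃B₅M⁵ε_kη²`. PROVED. [cite: Balaban1989LargeFieldI, (1.79)–(1.80) p.195] -/
theorem dev_le_of_ineq180 {dev εk η B₃ B₅ M δ dist C C₂ : ℝ} (h : B15.Ineq180 dev εk η B₃ B₅ M δ dist C)
    (hδ : 0 ≤ δ * dist) (hε : 0 ≤ εk) (hC : 0 ≤ C * B₃ * B₅ * M ^ 5) (hC₂ : 2 + C * B₃ * B₅ * M ^ 5 ≤ C₂ * B₃ * B₅ * M ^ 5) :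
    dev ≤ C₂ * B₃ * B₅ * M ^ 5 * εk * η ^ 2 := by
  unfold B15.Ineq180 at h
  have hexp : Real.exp (-δ * dist) ≤ 1 := by
    rw [Real.exp_le_one_iff]; linarith
  have hw : 0 ≤ εk * η ^ 2 := mul_nonneg hε (sq_nonneg η)
  have h1 : C * B₃ * B₅ * M ^ 5 * Real.exp (-δ * dist) * εk * η ^ 2 ≤ C * B₃ * B₅ * M ^ 5 * εk * η ^ 2 := by
    have := mul_le_mul_of_nonneg_left hexp hC
    nlinarith
  nlinarith

/-- **(1.31), object level, non-strict form**: `A(ζ₁, U₀) ≦ g_k²L^{−4N}(N^{β₀})⁴(C₁C₂²C₃⁴)A₀²B₃²B₅²M^{14}R_k⁴p₀²(g_k)` for the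
localized Wilson action, from the support count (`hS`, `Lm4N` = `L^{−4N}`, `nS = #S`), the (1.80)-shape per-plaquette
deviation on `S` (`hdev`), the trace inequality (`hquad`, `κ ≦ 1`), `ε_k = g_kA₀p₀(g_k)` (`hε`) and `R_{h+1} ≦ C₃N^{β₀}R_k`
(`hR`, `Nb` = `N^{β₀}`) — `B16Sect1Wilson.wilsonLoc_le_card_mul` followed by `B16Sect1Kernels.ineq131_arith`. PROVED.
[cite: Balaban1989LargeFieldII, (1.31) p.364] -/
theorem wilsonLoc_le_rhs131 (ζ₁ : Plaq P j → ℝ) (U₀ : GaugeField P j G) (S : Finset (Plaq P j))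
    {κ C₁ C₂ C₃ M Rh Rk Lm4N Nb B₃ B₅ εk η gk A₀ p₀ : ℝ}
    (hζ1 : ∀ p, ζ₁ p ≤ 1) (hsupp : ∀ p, p ∉ S → ζ₁ p = 0)
    (hquad : ∀ g : G, 1 - reTr g ≤ κ * dist1 g ^ 2) (hκ : κ ≤ 1)
    (hdev : ∀ p ∈ S, dist1 (plaqHol U₀ p) ≤ C₂ * B₃ * B₅ * M ^ 5 * εk * η ^ 2)
    (hC₁ : 0 ≤ C₁) (hM : 0 ≤ M) (hRh : 0 ≤ Rh) (hL : 0 ≤ Lm4N) (hη : η ≠ 0)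
    (hS : (S.card : ℝ) ≤ C₁ * M ^ 4 * Rh ^ 4 * Lm4N * (η ^ 4)⁻¹)
    (hε : εk = gk * A₀ * p₀) (hR : Rh ≤ C₃ * Nb * Rk) :
    wilsonLoc ζ₁ U₀ ≤
      gk ^ 2 * Lm4N * Nb ^ 4 * (C₁ * C₂ ^ 2 * C₃ ^ 4) * A₀ ^ 2 * B₃ ^ 2 * B₅ ^ 2 * M ^ 14 * Rk ^ 4 * p₀ ^ 2 := by
  set c : ℝ := (C₂ * B₃ * B₅ * M ^ 5 * εk * η ^ 2) ^ 2 with hc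
  -- per-plaquette: 1 − Re tr U₀(∂p) ≤ κ·dev² ≤ dev_max² = c
  have hplaq : ∀ p ∈ S, 1 - reTr (plaqHol U₀ p) ≤ c := by
    intro p hp
    have h1 := hquad (plaqHol U₀ p)
    have hd0 : 0 ≤ dist1 (plaqHol U₀ p) := GaugeGroup.dist1_nonneg _
    have h2 : dist1 (plaqHol U₀ p) ^ 2 ≤ c := by
      rw [hc]; exact pow_le_pow_left₀ hd0 (hdev p hp) 2
    have h3 : κ * dist1 (plaqHol U₀ p) ^ 2 ≤ dist1 (plaqHol U₀ p) ^ 2 := by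
      have := sq_nonneg (dist1 (plaqHol U₀ p)); nlinarith
    linarith
  have hA : wilsonLoc ζ₁ U₀ ≤ c * S.card := wilsonLoc_le_card_mul ζ₁ U₀ S c hζ1 hsupp hplaq
  have hc0 : 0 ≤ c := by rw [hc]; exact sq_nonneg _
  have hnS : c * (S.card : ℝ) ≤ c * (C₁ * M ^ 4 * Rh ^ 4 * Lm4N * (η ^ 4)⁻¹) := mul_le_mul_of_nonneg_left hS hc0
  have harith := B16Sect1Kernels.ineq131_arith (nS := C₁ * M ^ 4 * Rh ^ 4 * Lm4N * (η ^ 4)⁻¹) (c := c)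
    hC₁ hM hRh hL hη le_rfl hc hε hR
  linarith

/-- Bookkeeping of the exponents: `L^{−4N} = (L⁻¹)^{4N}` and `(N^{β₀})⁴ = N^{4β₀}` (real powers). [cite: Balaban1989LargeFieldII, (1.31) p.364] -/
theorem rpow_bookkeeping (N : ℕ) (β₀ : ℝ) : ((N : ℝ) ^ β₀) ^ 4 = (N : ℝ) ^ (4 * β₀) := by
  rw [← Real.rpow_natCast ((N : ℝ) ^ β₀) 4, ← Real.rpow_mul (Nat.cast_nonneg N)]
  norm_num [mul_comm]

/-- **(1.31) AS TYPED** (`B16Sect1Wilson.Ineq131 A g_k L⁻¹ N β₀ C A₀ B₃ B₅ M R_k p₀(g_k)` = `0 ≦ A ∧ A < g_k²(L⁻¹)^{4N}N^{4β₀}C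
A₀²B₃²B₅²M^{14}R_k⁴p₀²`), PROVED from the inputs of `wilsonLoc_le_rhs131` with `Lm4N = (L⁻¹)^{4N}`, `Nb = N^{β₀}`, a
nonnegative weight (`hζ0`, for the sign half `wilsonLoc_nonneg`), and the printed STRICT inequality obtained with the
`O(1)` explicit as `C₁C₂²C₃⁴ + 1` (the remaining factors positive: `hpos`). [cite: Balaban1989LargeFieldII, (1.31) p.364] -/
theorem ineq131_of_inputs (ζ₁ : Plaq P j → ℝ) (U₀ : GaugeField P j G) (S : Finset (Plaq P j))
    {κ C₁ C₂ C₃ M Rh Rk Linv B₃ B₅ εk η gk A₀ p₀ β₀ : ℝ} {N : ℕ}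
    (hζ0 : ∀ p, 0 ≤ ζ₁ p) (hζ1 : ∀ p, ζ₁ p ≤ 1) (hsupp : ∀ p, p ∉ S → ζ₁ p = 0)
    (hquad : ∀ g : G, 1 - reTr g ≤ κ * dist1 g ^ 2) (hκ : κ ≤ 1)
    (hdev : ∀ p ∈ S, dist1 (plaqHol U₀ p) ≤ C₂ * B₃ * B₅ * M ^ 5 * εk * η ^ 2)
    (hC₁ : 0 ≤ C₁) (hM : 0 ≤ M) (hRh : 0 ≤ Rh) (hL : 0 ≤ Linv) (hη : η ≠ 0)
    (hS : (S.card : ℝ) ≤ C₁ * M ^ 4 * Rh ^ 4 * Linv ^ (4 * N) * (η ^ 4)⁻¹)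
    (hε : εk = gk * A₀ * p₀) (hR : Rh ≤ C₃ * (N : ℝ) ^ β₀ * Rk)
    (hpos : 0 < gk ^ 2 * Linv ^ (4 * N) * (N : ℝ) ^ (4 * β₀) * A₀ ^ 2 * B₃ ^ 2 * B₅ ^ 2 * M ^ 14 * Rk ^ 4 * p₀ ^ 2) :
    Ineq131 (wilsonLoc ζ₁ U₀) gk Linv N β₀ (C₁ * C₂ ^ 2 * C₃ ^ 4 + 1) A₀ B₃ B₅ M Rk p₀ := by
  refine ⟨wilsonLoc_nonneg ζ₁ U₀ hζ0, ?_⟩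
  have h := wilsonLoc_le_rhs131 ζ₁ U₀ S hζ1 hsupp hquad hκ hdev hC₁ hM hRh (pow_nonneg hL _) hη hS hε hR
  rw [rpow_bookkeeping N β₀] at h
  have hX : 0 < gk ^ 2 * Linv ^ (4 * N) * (N : ℝ) ^ (4 * β₀) * A₀ ^ 2 * B₃ ^ 2 * B₅ ^ 2 * M ^ 14 * Rk ^ 4 * p₀ ^ 2 := hpos
  calc wilsonLoc ζ₁ U₀
      ≤ gk ^ 2 * Linv ^ (4 * N) * (N : ℝ) ^ (4 * β₀) * (C₁ * C₂ ^ 2 * C₃ ^ 4) * A₀ ^ 2 * B₃ ^ 2 * B₅ ^ 2 * M ^ 14 *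
          Rk ^ 4 * p₀ ^ 2 := h
    _ < gk ^ 2 * Linv ^ (4 * N) * (N : ℝ) ^ (4 * β₀) * (C₁ * C₂ ^ 2 * C₃ ^ 4 + 1) * A₀ ^ 2 * B₃ ^ 2 * B₅ ^ 2 * M ^ 14 *
          Rk ^ 4 * p₀ ^ 2 := by nlinarith

end Literature.MathematicalPhysics.QuantumFieldTheory.Balaban1983to89.B16Ineq131Assembly
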